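import Summits.AtomisticToContinuum.HydrodynamicLimit.Theorems.OneSphereInfluenceHardCorePoincareDobrushinSite

/-!
# OneSphereInfluenceHardCorePoincareDobrushinBounds — Model bounds for the local Gibbs profile

This file is part 2/9 of the DobrushinDoor chain proving the crux
`OneSphereInfluence.HardCorePoincare` (stmt-AtomisticToContinuum-13619) sorry-free; the closing
theorem `hardCorePoincare_holds` and the full account are in
`OneSphereInfluenceHardCorePoincareDobrushin.lean` (part 9/9). decomp-a2c · lens-1 · g39.

CONTENTS. Fubini for position events against the local Gibbs profile, the free region `posFree`,
`siteNorm` formulas, the two-ball volume bound and the UNIFORM lower bound on the free volume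
`siteNorm ≥ I − N·Aκε³`, and Dobrushin`s total-variation bound `siteKernel_tv`.
-/

open MeasureTheory ProbabilityTheory Set
open scoped ENNReal

noncomputable section

namespace Summit.AtomisticToContinuum.HydrodynamicLimit.Theorems.HardCorePoincareDobrushin

open Literature.MathematicalPhysics.KineticTheory Literature.Analysis.FluidPDE

/-! ## Chunk B — model bounds for the local Gibbs profile -/

section ModelBounds

variable {N : ℕ} {a₀ θ₀ : T3 → ℝ} {u₀ : T3 → V3}

/-- The unit-density local Maxwellian has unit mass (as a `lintegral`). -/
theorem lintegral_ofReal_localMaxwellian {θ : ℝ} (hθ : 0 < θ) (u : V3) :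
    ∫⁻ v, ENNReal.ofReal (localMaxwellian 1 θ u v) = 1 := by
  rw [← ofReal_integral_eq_lintegral_ofReal (integrable_localMaxwellian hθ u)
    (ae_of_all _ fun v => localMaxwellian_nonneg zero_le_one hθ.le u v),
    integral_localMaxwellian_one hθ u, ENNReal.ofReal_one]

/-- Fubini for a position event: `∫ 𝟙_B(q) a₀(q) M_{θ₀(q),u₀(q)}(v) d(q,v) = ∫_B a₀`. -/
theorem lintegral_indicator_fst_preimage_profile (hφm : Measurable (localGibbsProfile a₀ u₀ θ₀))
    (ha0 : ∀ x, 0 ≤ a₀ x) (hθ0 : ∀ x, 0 < θ₀ x) {B : Set T3} (hB : MeasurableSet B) :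
    ∫⁻ y, (Prod.fst ⁻¹' B).indicator (fun y => ENNReal.ofReal (localGibbsProfile a₀ u₀ θ₀ y)) y =
      ∫⁻ q in B, ENNReal.ofReal (a₀ q) := by
  have hmeas := hφm.ennreal_ofReal.indicator (measurable_fst hB)
  rw [Measure.volume_eq_prod, lintegral_prod _ hmeas.aemeasurable, ← lintegral_indicator hB]
  refine lintegral_congr fun q => ?_
  by_cases hq : q ∈ B
  · rw [indicator_of_mem hq]
    have h1 : ∀ v : V3, (Prod.fst ⁻¹' B).indicator
        (fun y => ENNReal.ofReal (localGibbsProfile a₀ u₀ θ₀ y)) (q, v) =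
        ENNReal.ofReal (a₀ q) * ENNReal.ofReal (localMaxwellian 1 (θ₀ q) (u₀ q) v) := by
      intro v
      rw [indicator_of_mem (show (q, v) ∈ Prod.fst ⁻¹' B from hq), localGibbsProfile,
        ENNReal.ofReal_mul (ha0 q)]
    simp_rw [h1]
    rw [lintegral_const_mul _
      (continuous_localMaxwellian 1 (θ₀ q) (u₀ q)).measurable.ennreal_ofReal,
      lintegral_ofReal_localMaxwellian (hθ0 q) (u₀ q), mul_one]
  · rw [indicator_of_notMem hq]
    have h1 : ∀ v : V3, (Prod.fst ⁻¹' B).indicator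
        (fun y => ENNReal.ofReal (localGibbsProfile a₀ u₀ θ₀ y)) (q, v) = 0 := fun v =>
      indicator_of_notMem (show (q, v) ∉ Prod.fst ⁻¹' B from hq) _
    simp_rw [h1, lintegral_zero]

/-- The set of positions at hard-core distance from every particle of `ω` is measurable. -/
theorem measurableSet_posFree (ε : ℝ) (ω : Config N (Fin 3) T3) : MeasurableSet (posFree ε ω) := by
  have h : posFree ε ω = {q : T3 | ∀ j : Fin N, ε ≤ Torus.euclidDist q (ω j).1} := rfl
  rw [h, setOf_forall]
  refine MeasurableSet.iInter fun j => measurableSet_le measurable_const ?_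
  have h1 : Measurable fun q : T3 => (q, (ω j).1) := measurable_id.prodMk measurable_const
  have h2 := measurable_euclidDist₂.comp h1
  exact h2

/-- `siteNorm` of the local Gibbs profile is the free `a₀`-volume. -/
theorem siteNorm_eq (hφm : Measurable (localGibbsProfile a₀ u₀ θ₀)) (ha0 : ∀ x, 0 ≤ a₀ x)
    (hθ0 : ∀ x, 0 < θ₀ x) (ε : ℝ) (ω : Config N (Fin 3) T3) :
    siteNorm (localGibbsProfile a₀ u₀ θ₀) ε ω = ∫⁻ q in posFree ε ω, ENNReal.ofReal (a₀ q) := by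
  rw [siteNorm]
  exact lintegral_indicator_fst_preimage_profile hφm ha0 hθ0 (measurableSet_posFree ε ω)

/-- The normalising constant of the local Gibbs profile is at most `∫ a₀`. -/
theorem siteNorm_le (ha : Continuous a₀) (hφm : Measurable (localGibbsProfile a₀ u₀ θ₀))
    (ha0 : ∀ x, 0 ≤ a₀ x) (hθ0 : ∀ x, 0 < θ₀ x) (ε : ℝ) (ω : Config N (Fin 3) T3) :
    siteNorm (localGibbsProfile a₀ u₀ θ₀) ε ω ≤ ENNReal.ofReal (∫ q, a₀ q) := by
  rw [siteNorm_eq hφm ha0 hθ0, ofReal_integral_eq_lintegral_ofReal (integrable_of_continuous_T3 ha)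
    (ae_of_all _ fun q => ha0 q)]
  exact setLIntegral_le_lintegral _ _

/-- The normalising constant of the local Gibbs profile is finite. -/
theorem siteNorm_ne_top (ha : Continuous a₀) (hφm : Measurable (localGibbsProfile a₀ u₀ θ₀))
    (ha0 : ∀ x, 0 ≤ a₀ x) (hθ0 : ∀ x, 0 < θ₀ x) (ε : ℝ) (ω : Config N (Fin 3) T3) :
    siteNorm (localGibbsProfile a₀ u₀ θ₀) ε ω ≠ ⊤ :=
  ne_top_of_le_ne_top ENNReal.ofReal_ne_top (siteNorm_le ha hφm ha0 hθ0 ε ω)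

/-- Mass of one excluded ball: `∫_{B_r(c)} a₀ ≤ A · (4π/3) r³`. -/
theorem setLIntegral_ball_le {A : ℝ} (hA : ∀ x, a₀ x ≤ A) (hA0 : 0 ≤ A) {r : ℝ} (hr0 : 0 ≤ r)
    (hr : r < 1 / 2) (c : T3) :
    ∫⁻ q in {q : T3 | Torus.euclidDist q c < r}, ENNReal.ofReal (a₀ q) ≤
      ENNReal.ofReal (A * (r ^ 3 * (Real.pi * 4 / 3))) := by
  calc ∫⁻ q in {q : T3 | Torus.euclidDist q c < r}, ENNReal.ofReal (a₀ q)
      ≤ ∫⁻ q in {q : T3 | Torus.euclidDist q c < r}, ENNReal.ofReal A :=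
        lintegral_mono fun q => ENNReal.ofReal_le_ofReal (hA q)
    _ = ENNReal.ofReal A * volume {q : T3 | Torus.euclidDist q c < r} := setLIntegral_const _ _
    _ = ENNReal.ofReal (A * (r ^ 3 * (Real.pi * 4 / 3))) := by
        rw [Torus.volume_euclidDist_lt hr c, EuclideanSpace.volume_ball_fin_three,
          ENNReal.ofReal_mul hA0, ENNReal.ofReal_mul (pow_nonneg hr0 3), ENNReal.ofReal_pow hr0]

/-- The excluded volume seen by one site: `∫_{(posFree)ᶜ} a₀ ≤ N · A · (4π/3) ε³`. -/
theorem lintegral_compl_posFree_le {A : ℝ} (hA : ∀ x, a₀ x ≤ A) (hA0 : 0 ≤ A) {ε : ℝ}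
    (hε0 : 0 ≤ ε) (hε : ε < 1 / 2) (ω : Config N (Fin 3) T3) :
    ∫⁻ q in (posFree ε ω)ᶜ, ENNReal.ofReal (a₀ q) ≤
      ENNReal.ofReal (N * (A * (ε ^ 3 * (Real.pi * 4 / 3)))) := by
  have hsub : (posFree ε ω)ᶜ ⊆ ⋃ j : Fin N, {q : T3 | Torus.euclidDist q (ω j).1 < ε} := by
    intro q hq
    simp only [posFree, mem_compl_iff, mem_setOf_eq, not_forall, not_le] at hq
    obtain ⟨j, hj⟩ := hq
    exact mem_iUnion.2 ⟨j, hj⟩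
  calc ∫⁻ q in (posFree ε ω)ᶜ, ENNReal.ofReal (a₀ q)
      ≤ ∫⁻ q in ⋃ j : Fin N, {q : T3 | Torus.euclidDist q (ω j).1 < ε}, ENNReal.ofReal (a₀ q) :=
        lintegral_mono_set hsub
    _ ≤ ∑' j : Fin N, ∫⁻ q in {q : T3 | Torus.euclidDist q (ω j).1 < ε}, ENNReal.ofReal (a₀ q) :=
        lintegral_iUnion_le _ _
    _ ≤ ∑' _j : Fin N, ENNReal.ofReal (A * (ε ^ 3 * (Real.pi * 4 / 3))) :=
        ENNReal.tsum_le_tsum fun j => setLIntegral_ball_le hA hA0 hε0 hε _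
    _ = ENNReal.ofReal (N * (A * (ε ^ 3 * (Real.pi * 4 / 3)))) := by
        rw [tsum_fintype, Finset.sum_const, Finset.card_univ, Fintype.card_fin, nsmul_eq_mul,
          ENNReal.ofReal_mul (Nat.cast_nonneg N), ENNReal.ofReal_natCast]

/-- **Uniform lower bound on the free volume**: `siteNorm ≥ ∫ a₀ − N · A · (4π/3) ε³`. -/
theorem le_siteNorm (ha : Continuous a₀) (hφm : Measurable (localGibbsProfile a₀ u₀ θ₀))
    (ha0 : ∀ x, 0 ≤ a₀ x) (hθ0 : ∀ x, 0 < θ₀ x) {A : ℝ} (hA : ∀ x, a₀ x ≤ A) (hA0 : 0 ≤ A)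
    {ε : ℝ} (hε0 : 0 ≤ ε) (hε : ε < 1 / 2) (ω : Config N (Fin 3) T3) :
    ENNReal.ofReal ((∫ q, a₀ q) - N * (A * (ε ^ 3 * (Real.pi * 4 / 3)))) ≤
      siteNorm (localGibbsProfile a₀ u₀ θ₀) ε ω := by
  have hnn : 0 ≤ (N : ℝ) * (A * (ε ^ 3 * (Real.pi * 4 / 3))) :=
    mul_nonneg (Nat.cast_nonneg N) (mul_nonneg hA0 (mul_nonneg (pow_nonneg hε0 3) (by positivity)))
  rw [siteNorm_eq hφm ha0 hθ0, ENNReal.ofReal_sub _ hnn, tsub_le_iff_right,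
    ofReal_integral_eq_lintegral_ofReal (integrable_of_continuous_T3 ha) (ae_of_all _ fun q => ha0 q),
    ← lintegral_add_compl _ (measurableSet_posFree ε ω)]
  exact add_le_add le_rfl (lintegral_compl_posFree_le hA hA0 hε0 hε ω)

/-- Off the two balls around the old and the new position of particle `j`, the resampling
weights of site `i` before and after the move of `j` agree. -/
theorem siteWeight_update_eq (φ : T3 × V3 → ℝ) (ε : ℝ) (i j : Fin (N + 1))
    (z : Config (N + 1) (Fin 3) T3) (y y₀ : T3 × V3)
    (h1 : ε ≤ Torus.euclidDist y₀.1 (z j).1) (h2 : ε ≤ Torus.euclidDist y₀.1 y.1) :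
    siteWeight φ ε (i.removeNth (Function.update z j y)) y₀ = siteWeight φ ε (i.removeNth z) y₀ := by
  have hiff : y₀ ∈ freeSet ε (i.removeNth (Function.update z j y)) ↔
      y₀ ∈ freeSet ε (i.removeNth z) := by
    simp only [freeSet, posFree, mem_preimage, mem_setOf_eq, Fin.removeNth]
    refine forall_congr' fun k => ?_
    by_cases hk : i.succAbove k = j
    · rw [hk, Function.update_self]
      exact ⟨fun _ => h1, fun _ => h2⟩
    · rw [Function.update_of_ne hk]
  by_cases hm : y₀ ∈ freeSet ε (i.removeNth z)
  · rw [siteWeight, siteWeight, indicator_of_mem hm, indicator_of_mem (hiff.2 hm)]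
  · rw [siteWeight, siteWeight, indicator_of_notMem hm, indicator_of_notMem (mt hiff.1 hm)]

/-- Mass of the two excluded balls under the profile: `≤ 2 · A · (4π/3) ε³`. -/
theorem lintegral_twoBalls_le (hφm : Measurable (localGibbsProfile a₀ u₀ θ₀))
    (ha0 : ∀ x, 0 ≤ a₀ x) (hθ0 : ∀ x, 0 < θ₀ x) {A : ℝ} (hA : ∀ x, a₀ x ≤ A) (hA0 : 0 ≤ A)
    {ε : ℝ} (hε0 : 0 ≤ ε) (hε : ε < 1 / 2) (c₁ c₂ : T3) :
    ∫⁻ y₀ in Prod.fst ⁻¹' ({q : T3 | Torus.euclidDist q c₁ < ε} ∪ {q | Torus.euclidDist q c₂ < ε}),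
        ENNReal.ofReal (localGibbsProfile a₀ u₀ θ₀ y₀) ≤
      ENNReal.ofReal (2 * (A * (ε ^ 3 * (Real.pi * 4 / 3)))) := by
  -- (the tree's `DensityCapNegative.measurableSet_euclidBall`, inlined to keep this chain's imports small)
  have measurableSet_ballPos : ∀ (c : T3) (r : ℝ),
      MeasurableSet {q : T3 | Torus.euclidDist q c < r} := by
    intro c r
    have h1 : Measurable fun q : T3 => (q, c) := measurable_id.prodMk measurable_const
    have h2 := measurable_euclidDist₂.comp h1
    exact measurableSet_lt h2 measurable_const
  have hB : MeasurableSet ({q : T3 | Torus.euclidDist q c₁ < ε} ∪ {q | Torus.euclidDist q c₂ < ε}) :=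
    (measurableSet_ballPos c₁ ε).union (measurableSet_ballPos c₂ ε)
  have hm0 : 0 ≤ A * (ε ^ 3 * (Real.pi * 4 / 3)) :=
    mul_nonneg hA0 (mul_nonneg (pow_nonneg hε0 3) (by positivity))
  rw [← lintegral_indicator (measurable_fst hB),
    lintegral_indicator_fst_preimage_profile hφm ha0 hθ0 hB]
  calc ∫⁻ q in {q : T3 | Torus.euclidDist q c₁ < ε} ∪ {q | Torus.euclidDist q c₂ < ε},
        ENNReal.ofReal (a₀ q)
      ≤ (∫⁻ q in {q : T3 | Torus.euclidDist q c₁ < ε}, ENNReal.ofReal (a₀ q)) +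
          ∫⁻ q in {q : T3 | Torus.euclidDist q c₂ < ε}, ENNReal.ofReal (a₀ q) :=
        lintegral_union_le _ _ _
    _ ≤ ENNReal.ofReal (A * (ε ^ 3 * (Real.pi * 4 / 3))) +
          ENNReal.ofReal (A * (ε ^ 3 * (Real.pi * 4 / 3))) :=
        add_le_add (setLIntegral_ball_le hA hA0 hε0 hε _) (setLIntegral_ball_le hA hA0 hε0 hε _)
    _ = ENNReal.ofReal (2 * (A * (ε ^ 3 * (Real.pi * 4 / 3)))) := by
        rw [two_mul, ENNReal.ofReal_add hm0 hm0]

/-- **Dobrushin interdependence bound** for the one-site heat-bath kernels of the local Gibbs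
profile: moving particle `j` changes the law of the resampled particle `i` by at most
`2 · (2A(4π/3)ε³) / (∫a₀ − N A (4π/3) ε³)` in total variation. -/
theorem siteKernel_tv (ha : Continuous a₀) (hφm : Measurable (localGibbsProfile a₀ u₀ θ₀))
    (ha0 : ∀ x, 0 ≤ a₀ x) (hθ0 : ∀ x, 0 < θ₀ x) {A : ℝ} (hA : ∀ x, a₀ x ≤ A) (hA0 : 0 ≤ A)
    {ε : ℝ} (hε0 : 0 ≤ ε) (hε : ε < 1 / 2)
    (hL : 0 < (∫ q, a₀ q) - N * (A * (ε ^ 3 * (Real.pi * 4 / 3))))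
    (i j : Fin (N + 1)) (z : Config (N + 1) (Fin 3) T3) (y : T3 × V3) {S : Set (T3 × V3)}
    (hS : MeasurableSet S) :
    ((siteKernel hφm ε i z) S).toReal ≤ ((siteKernel hφm ε i (Function.update z j y)) S).toReal +
      2 * (2 * (A * (ε ^ 3 * (Real.pi * 4 / 3))) /
        ((∫ q, a₀ q) - N * (A * (ε ^ 3 * (Real.pi * 4 / 3))))) := by
  have measurableSet_ballPos : ∀ (c : T3) (r : ℝ),
      MeasurableSet {q : T3 | Torus.euclidDist q c < r} := by
    intro c r
    have h1 : Measurable fun q : T3 => (q, c) := measurable_id.prodMk measurable_const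
    have h2 := measurable_euclidDist₂.comp h1
    exact measurableSet_lt h2 measurable_const
  have hBad : MeasurableSet (Prod.fst ⁻¹' ({q : T3 | Torus.euclidDist q (z j).1 < ε} ∪
      {q | Torus.euclidDist q y.1 < ε}) : Set (T3 × V3)) :=
    measurable_fst ((measurableSet_ballPos (z j).1 ε).union (measurableSet_ballPos y.1 ε))
  have hmass := lintegral_twoBalls_le hφm ha0 hθ0 hA hA0 hε0 hε (z j).1 y.1
  have hm0 : 0 ≤ 2 * (A * (ε ^ 3 * (Real.pi * 4 / 3))) :=
    mul_nonneg zero_le_two (mul_nonneg hA0 (mul_nonneg (pow_nonneg hε0 3) (by positivity)))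
  have key := toReal_normalised_le (ν := (volume : Measure (T3 × V3)))
    (w := siteWeight (localGibbsProfile a₀ u₀ θ₀) ε (i.removeNth z))
    (w' := siteWeight (localGibbsProfile a₀ u₀ θ₀) ε (i.removeNth (Function.update z j y)))
    (ψ := fun y₀ => ENNReal.ofReal (localGibbsProfile a₀ u₀ θ₀ y₀)) hBad
    (fun y₀ => siteWeight_le _ ε _ y₀) (fun y₀ => siteWeight_le _ ε _ y₀)
    (fun y₀ hy₀ => by
      simp only [mem_preimage, mem_union, mem_setOf_eq, not_or, not_lt] at hy₀
      exact (siteWeight_update_eq _ ε i j z y y₀ hy₀.1 hy₀.2).symm)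
    (L := ENNReal.ofReal ((∫ q, a₀ q) - N * (A * (ε ^ 3 * (Real.pi * 4 / 3)))))
    (ENNReal.ofReal_pos.2 hL).ne'
    (le_siteNorm ha hφm ha0 hθ0 hA hA0 hε0 hε _) (le_siteNorm ha hφm ha0 hθ0 hA hA0 hε0 hε _)
    (siteNorm_ne_top ha hφm ha0 hθ0 ε _) (siteNorm_ne_top ha hφm ha0 hθ0 ε _)
    (ne_top_of_le_ne_top ENNReal.ofReal_ne_top hmass) hS
  rw [ENNReal.toReal_ofReal hL.le] at key
  have h1 := ENNReal.toReal_le_of_le_ofReal hm0 hmass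
  have h2 := mul_le_mul_of_nonneg_left (div_le_div_of_nonneg_right h1 hL.le) (zero_le_two (α := ℝ))
  exact key.trans (add_le_add le_rfl h2)

end ModelBounds

end Summit.AtomisticToContinuum.HydrodynamicLimit.Theorems.HardCorePoincareDobrushin

end
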